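import Literature.Computability.QuantumComplexity.GRStagePlaced
import Literature.Computability.QuantumComplexity.QFTStagePlaced
import HarnessLib

/-!
# Wires of the placed stages: every gate lives in one block

Topic `Literature/Computability/QuantumComplexity`; sequel of `GRStagePlaced.lean` (`GRStage.stageCircuit D E`:
the Grover–Rudolph blocks placed along `E : Fin n → (Fin B ↪ Fin W)`), `QFTStagePlaced.lean`
(`QFTStage.stageCircuit E hk1`) and `CircuitEmbedding.lean` (`wires_mapWiresGate_subset`, `BlockDisjoint`).
Bookkeeping for the idle-slot argument of Regev's one-copy sampler (J. ACM 56 (2009), art. 34,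
Lemma 3.14; `IdleGatesInvariance.lean`): the sampler's circuit at input length `m` carries coordinate
slots for every dimension `n ≤ m`, and the gates of the slots an instance does not use must be recognised
as acting inside the **idle wires**.

* `mem_gates_chainCircuit` — a gate of a chain is a gate of a member;
* `GRStage.exists_block_of_mem_stageCircuit`, `QFTStage.exists_block_of_mem_stageCircuit` — every gate
  of a placed stage has its wires inside one block `Set.range (E i)`;
* `idleWires E U` — the wires of the blocks outside the used index set `U`; for disjoint blocks a gate
  inside block `i` has wires `⊆ idleWires E U` if `i ∉ U` and disjoint from them if `i ∈ U`
  (`wires_subset_idleWires`, `disjoint_wires_idleWires`), whence the dichotomy hypotheses of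
  `IdleGatesInvariance.toMatrix_eq_filter_mul` for the predicate `g.wires ⊆ idleWires E U`
  (`stage_dichotomy`).

Everything is proved; no named fact is introduced.

## References

* O. Regev, *On lattices, learning with errors, random linear codes, and cryptography*, J. ACM 56
  (2009), art. 34, Lemma 3.14 [Regev2009].
* M. A. Nielsen, I. L. Chuang, *Quantum Computation and Quantum Information*, CUP 2010, §2.1.7, §4.2
  [NielsenChuang2010].
-/

noncomputable section

open Matrix Finset

namespace Literature.Computability.QuantumComplexity

open Cryptography

/-- A gate of a chain is a gate of one of its members. [folklore] -/
theorem mem_gates_chainCircuit {N : ℕ} {g : QGate cliffordT N} :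
    ∀ {L : List (QCircuit cliffordT N)}, g ∈ (chainCircuit L).gates ↔ ∃ C ∈ L, g ∈ C.gates
  | [] => by simp [chainCircuit]
  | C :: Cs => by
    rw [chainCircuit, QCircuit.gates_append, List.mem_append, mem_gates_chainCircuit (L := Cs)]
    constructor
    · rintro (⟨C', hC', h⟩ | h)
      · exact ⟨C', List.mem_cons_of_mem C hC', h⟩
      · exact ⟨C, List.mem_cons_self, h⟩
    · rintro ⟨C', hC', h⟩
      rcases List.mem_cons.1 hC' with rfl | hC'
      · exact Or.inr h
      · exact Or.inl ⟨C', hC', h⟩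

/-- Every gate of a transported circuit has its wires inside the block. [cite: NielsenChuang2010, §4.2] -/
theorem wires_subset_range_of_mem_mapWires {G : QGateSet} {b W : ℕ} (E : Fin b ↪ Fin W) (C : QCircuit G b)
    {g : QGate G W} (hg : g ∈ (mapWires E C).gates) : ∀ w ∈ g.wires, w ∈ Set.range E := by
  obtain ⟨g', -, rfl⟩ := List.mem_map.1 hg
  exact wires_mapWiresGate_subset E g'

namespace GRStage

/-- **Every gate of the placed Grover–Rudolph stage lives in one block.** [cite: Regev2009, Lemma 3.14] -/
theorem exists_block_of_mem_stageCircuit {B ℓ n W : ℕ} {kit : GadgetKit B} {ws : Fin ℓ ↪ Fin B} {np : ℕ}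
    {pw : Fin np ↪ Fin B} {a : Fin ℓ → (Fin ℓ → Bool) → ℝ} (D : GRBlock.Data kit ws pw a)
    (E : Fin n → (Fin B ↪ Fin W)) {g : QGate cliffordT W} (hg : g ∈ (stageCircuit D E).gates) :
    ∃ i, ∀ w ∈ g.wires, w ∈ Set.range (E i) := by
  simp only [stageCircuit, List.mem_flatMap, List.mem_finRange, true_and] at hg
  obtain ⟨i, hg⟩ := hg
  exact ⟨i, wires_subset_range_of_mem_mapWires (E i) _ hg⟩

end GRStage

namespace QFTStage

/-- **Every gate of the placed Fourier stage lives in one block.** [cite: Regev2009, Lemma 3.14] -/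
theorem exists_block_of_mem_stageCircuit {κ k n W : ℕ} (E : Fin n → (Fin (QFTKit.qbsize κ k) ↪ Fin W)) (hk1 : 1 ≤ k)
    {g : QGate cliffordT W} (hg : g ∈ (stageCircuit E hk1).gates) : ∃ i, ∀ w ∈ g.wires, w ∈ Set.range (E i) := by
  obtain ⟨C, hC, hg⟩ := mem_gates_chainCircuit.1 hg
  rw [List.mem_reverse, List.mem_ofFn] at hC
  obtain ⟨i, rfl⟩ := hC
  exact ⟨i, wires_subset_range_of_mem_mapWires (E i) _ hg⟩

end QFTStage

/-! ### Idle wires of unused blocks -/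

section Idle

variable {b n W : ℕ} (E : Fin n → (Fin b ↪ Fin W)) (U : Finset (Fin n))

/-- The **idle wires**: the wires of the blocks whose index is outside the used set `U`. [cite: Regev2009, Lemma 3.14] -/
def idleWires : Finset (Fin W) := Finset.univ.filter fun w => ∃ i, i ∉ U ∧ w ∈ Set.range (E i)

variable {E U}

/-- Membership in the idle wires. [folklore] -/
theorem mem_idleWires {w : Fin W} : w ∈ idleWires E U ↔ ∃ i, i ∉ U ∧ w ∈ Set.range (E i) := by
  simp [idleWires]

/-- A gate inside an unused block acts on idle wires only. [folklore] -/
theorem wires_subset_idleWires {g : QGate cliffordT W} {i : Fin n} (hi : i ∉ U)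
    (hg : ∀ w ∈ g.wires, w ∈ Set.range (E i)) : g.wires ⊆ idleWires E U :=
  fun w hw => mem_idleWires.2 ⟨i, hi, hg w hw⟩

/-- For disjoint blocks, a gate inside a used block avoids the idle wires. [folklore] -/
theorem disjoint_wires_idleWires (hE : BlockDisjoint E) {g : QGate cliffordT W} {i : Fin n} (hi : i ∈ U)
    (hg : ∀ w ∈ g.wires, w ∈ Set.range (E i)) : Disjoint g.wires (idleWires E U) := by
  refine Finset.disjoint_left.2 fun w hw hT => ?_
  obtain ⟨j, hj, hwj⟩ := mem_idleWires.1 hT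
  exact Set.disjoint_left.1 (hE i j (fun h => hj (h ▸ hi))) (hg w hw) hwj

/-- **The idle dichotomy of a placed stage**: for disjoint blocks, every gate living in one block either
acts inside the idle wires or avoids them — the two hypotheses of
`IdleGatesInvariance.toMatrix_eq_filter_mul` for the predicate `g.wires ⊆ idleWires E U`.
[cite: Regev2009, Lemma 3.14] [cite: NielsenChuang2010, §2.1.7] -/
theorem stage_dichotomy (hE : BlockDisjoint E) {gs : List (QGate cliffordT W)}
    (hgs : ∀ g ∈ gs, ∃ i, ∀ w ∈ g.wires, w ∈ Set.range (E i)) :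
    (∀ g ∈ gs, decide (g.wires ⊆ idleWires E U) = true → g.wires ⊆ idleWires E U) ∧
      (∀ g ∈ gs, decide (g.wires ⊆ idleWires E U) = false → Disjoint g.wires (idleWires E U)) := by
  refine ⟨fun g _ h => of_decide_eq_true h, fun g hg h => ?_⟩
  obtain ⟨i, hi⟩ := hgs g hg
  by_cases hiU : i ∈ U
  · exact disjoint_wires_idleWires hE hiU hi
  · exact absurd (decide_eq_true (wires_subset_idleWires hiU hi)) (by rw [h]; decide)

/-- A read-out that only looks at wires outside the idle ones ignores changes on them: if `z, z'` agree
off `idleWires E U` they agree on every used block and off all blocks. [folklore] -/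
theorem eq_on_used_of_eq_off_idleWires {z z' : QReg W} (h : ∀ w, w ∉ idleWires E U → z w = z' w)
    {i : Fin n} (hE : BlockDisjoint E) (hi : i ∈ U) (q : Fin b) : z (E i q) = z' (E i q) :=
  h _ fun hT => by
    obtain ⟨j, hj, hwj⟩ := mem_idleWires.1 hT
    exact Set.disjoint_left.1 (hE i j (fun h => hj (h ▸ hi))) ⟨q, rfl⟩ hwj

end Idle

end Literature.Computability.QuantumComplexity

end
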